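import Mathlib.Analysis.SpecialFunctions.Trigonometric.Deriv
import Mathlib.Analysis.SpecialFunctions.Trigonometric.Inverse
import Literature.MathematicalPhysics.QuantumLattice.NodalHeatTransportDictionary
import Literature.MathematicalPhysics.QuantumLattice.UpperCriticalFieldGLBrackets
import HarnessLib

/-!
# The non-monotonic d-wave gap of the electron-doped cuprates, the SC gap by probe, and the
# AF-correlation-length dictionary of oxygen-reduced Nd₂₋ₓCeₓCuO₄ (REFVALS-2 §146)

Two printed dictionaries of the electron-doped (T′) cuprates, typed as exact algebra and
rational/`π`-bracket arithmetic on the numbers AS PRINTED (cell hubbard-downfold, seat lit-2,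
`REFVALS-2.md` §146; every number [float]; no physics beyond the printed formulae):

**(A) The non-monotonic `d_{x²−y²}` gap function.** Raman scattering on Nd₂₋ₓCeₓCuO₄ /
Pr₂₋ₓCeₓCuO₄ (Blumberg et al. 2002; Qazilbash et al. 2005) and ARPES on Pr₀.₈₉LaCe₀.₁₁CuO₄
(Matsui et al. 2005) are summarised by [ArmitageFournierGreene2010, §IV.A.3–4, pp. 38–40]:
«the maximum value of the gap function (Δmax ∼ 4 meV) coincides with the 'hot spots' … At the zone
boundary … the gap value drops to ∼ 3 meV», and «Matsui et al. fit their data with the function: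
∆ = ∆₀[1.43 cos 2φ − 0.43 cos 6φ], with ∆₀ = 1.9 meV … the maximum value of the gap extracted from
the ARPES data (∆max ∼ 2.5 meV)»; the same review then estimates the nodal heat transport twice
[ArmitageFournierGreene2010, §IV.A.6, p. 42]: «v₂ = 2∆₀/ħk_F assuming a monotonic d-wave gap with the
tunnelling maximum value of ∆₀ ∼ 4 meV … gives v_F/v₂ ∼ 96 and κ_el/T ≈ 0.96 mW/K²-cm … Assuming
instead a non-monotonic d-wave gap … with ∆₀ = 3 meV … leads to v_F/v₂ ∼ 47, and κ_el/T ≈ 0.47».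
§1–§3 below prove the exact content of that form `g(φ) = 1.43 cos 2φ − 0.43 cos 6φ`:
`g(0) = 1` (so `Δ₀` IS the zone-boundary value), `g(π/4) = 0` (the node survives), the triple-angle
reduction `g = cos 2φ · (2.72 − 1.72 cos² 2φ)`, `HasDerivAt` with nodal slope `−5.44` (vs `−2` for
`cos 2φ`, reusing `dWaveGap` of `NodalHeatTransportDictionary`), the critical-point equation
`sin² 2φ = 4.88/10.32` (equivalently `cos² 2φ = 2.72/5.16`), the global bracket
`g ≤ 1.3166` with a witness `φ* ∈ (0, π/4)`, `g(φ*) > 1.3165` — hence `Δ_max ∈ (2.501, 2.502) Δ₀/1.9`,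
i.e. `(2.501, 2.502)` meV at `Δ₀ = 1.9` and `(3.949, 3.950)` meV at `Δ₀ = 3` (BOTH printed maxima from
the one printed form) — and the transport pair: slope ratio `(5.44·3)/(2·4) = 2.04`,
`96/2.04 ∈ (47.05, 47.06)`, `0.96 · A(47.06)/A(96) ∈ (0.470, 0.471)` with `A(r) = r + 1/r`
(`anisotropySum`).

**(B) The SC gap BY PROBE** [ArmitageFournierGreene2010, §III.B p. 24, §III.D p. 30, §IV.A pp. 37–43]
as `2Δ/k_BT_c` arithmetic (`tunnellingGapRatio`, `invCmToMeV` of `SpectroscopicGapRatio`): STM on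
PLCCO `x = 0.12`, `T_c = 24 K`, «average gap … 7.2 ± 1.2 meV, which gives a 2Δ/k_BT_c ratio of 7.5»
↦ the exact image at the printed `T_c` is `(6.96, 6.97)` (`6.5 / 7.0 meV ↦ (6.28, 6.29) / (6.76, 6.77)`;
`7.5` needs `Δ ∈ (7.755, 7.757)` meV); optics «∆₀ ≈ 35 cm⁻¹ (4.3 meV) … 2∆/k_BT_c … approximately 5»
↦ `35 cm⁻¹ ∈ (4.339, 4.34) meV` and ratio `5` at `4.3 meV` ⇔ `T_c ∈ (19.9, 20.0) K`; NMR
«2∆₀ = 3.8 k_BT_c» ↦ `Δ₀/T_c ∈ (0.1637, 0.1638) meV/K`.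

**(C) The AF-correlation-length dictionary** of [MotoyamaEtAl2007NCCOSpinCorrelations, pp. 1–4]:
«the AF phase boundary in fact terminates at x_AF = 0.134(4)»; along the pseudogap temperature `T*`,
«ξ*/a = C/(x_c − x) (2) with fitting parameters C = 0.96(12) and x_c = 0.171(4)»; «Using the value
v_F = 2.2 × 10⁷ cm/s … we find that ξ* = 2.6(2) ξ_th», `ξ_th = ħv_F/(πk_BT)`; «at optimal doping
(x = 0.15), ξ* ≈ ξ₀ is comparable to the SC coherence length ξ_SC = 58 Å ≈ 15a».  §5–§7 type:
`ξ_th·T/a = ħv_F/(πk_B a) ∈ (1354.1, 1354.2) K` at `a = 3.95 Å` (reusing `hbarSI`, `boltzmannSI`);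
`ξ*/a` rows at `x = 0.100 / 0.125 / 0.134 / 0.140 / 0.145 / 0.150` with the `(C ± 0.12, x_c ± 0.004)`
corner bracket `[11.2, 16.12)` at `x = 0.10`, monotonicity in `C`, `x_c`, `x`; the COMPOSED crossover
temperature `T*(x) = 2.6 (ξ_th T/a)(x_c − x)/C` (DERIVED, value-free): `(260, 261)`, `(168, 169)`,
`(135, 136)`, `(113, 114)`, `(95, 96)`, `(77, 77.1)` K; the GL image of `ξ_SC = 58 Å`,
`Φ₀/(2πξ²) ∈ (9.78, 9.79) T` (reusing `bGL` of `UpperCriticalFieldGLBrackets`); `58 Å/3.95 Å ∈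
(14.68, 14.69)`; and Onose's optical pseudogap rule «∆_pg = 10k_BT*» [ArmitageFournierGreene2010,
§III.D p. 28] as `T* = Δ_pg/(10k_B)`: `0.2 / 0.3 / 0.4 eV ↦ (232.0, 232.2) / (348.1, 348.2) /
(464.1, 464.3) K`.

**(D) §8 (appended, REFVALS-2 §148)** The one-parameter harmonic family
`h_B(φ) = B cos 2φ + (1 − B) cos 6φ` used for the hole-doped single-layer cuprates
[KondoEtAl2007Bi2201TwoEnergyScales, p. 3] («B = 0.78» optimally doped (Bi,Pb)₂(Sr,La)₂CuO₆₊δ,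
«B = 0.88» underdoped Bi-2212): `gapShape = h_{1.43}` (bridge to §1), `h_B(0) = 1`, node at `π/4` for
every `B`, `HasDerivAt` nodal slope `−(8B − 6)` (`0.24 / 1.04 / 2 / 5.44` at `B = 0.78 / 0.88 / 1 / 1.43`),
the reduction `h_B = cos 2φ·((4B − 3) + 4(1 − B)cos² 2φ)`, and `|h_B| ≤ |cos 2φ|` for `3/4 ≤ B ≤ 1`
(a `B < 1` harmonic flattens the node and never exceeds the antinodal value); plus the §148 arithmetic
(`2Δ/k_BT_c` rows of [KondoEtAl2007Bi2201TwoEnergyScales], [OkadaEtAl2011Bi2201ThreeEnergyScales],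
[BoyerEtAl2007Bi2201TwoGapsSTM], [YoshidaEtAl2009LSCOTwoGapARPES], [RazzoliEtAl2013LSCONodelessGap] and
the printed `2Δ/k_BT = 4.3` rule as the maps `T ↦ 4.3k_BT/2`, `Δ ↦ 2Δ/(4.3k_B)`).

No new notions are introduced beyond three printed functions (`gapShape`, `harmonicDWave`,
`xiStarOverA`) and unit-bookkeeping abbreviations; everything else is REUSED from `NodalHeatTransportDictionary`,
`SpectroscopicGapRatio`, `OnsagerLuttingerCount`, `UpperCriticalFieldGLBrackets`.  Which probe sees
«the» gap, and whether AF and SC coexist in T′ cuprates, are the sources' statements, not this file's.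
AI-produced formalisation (H21, cell hubbard-downfold, seat lit-2, 2026-08-29); no facts, no axioms
beyond Mathlib's, no `sorry`.
-/

noncomputable section

open Real
open Literature.MathematicalPhysics.QuantumLattice
open Literature.MathematicalPhysics.QuantumLattice.NodalHeatTransport
open Literature.MathematicalPhysics.QuantumLattice.UpperCriticalFieldGL

namespace Literature.MathematicalPhysics.QuantumLattice.NonmonotonicDWaveGap

/-! ## §1 The printed form `g(φ) = 1.43 cos 2φ − 0.43 cos 6φ` -/

/-- The angular shape of the non-monotonic `d_{x²−y²}` gap, `g(φ) = 1.43 cos 2φ − 0.43 cos 6φ`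
(`φ` measured from the Cu–O bond direction). [cite: ArmitageFournierGreene2010, §IV.A.4 p. 40] -/
def gapShape (φ : ℝ) : ℝ := 1.43 * cos (2 * φ) - 0.43 * cos (6 * φ)

/-- Unfolding. [cite: ArmitageFournierGreene2010, §IV.A.4 p. 40] -/
theorem gapShape_def (φ : ℝ) : gapShape φ = 1.43 * cos (2 * φ) - 0.43 * cos (6 * φ) := rfl

/-- The non-monotonic d-wave gap `Δ(φ) = Δ₀ g(φ)` of Blumberg et al. / Matsui et al.
[cite: ArmitageFournierGreene2010, §IV.A.4 p. 40] -/
def gap (Δ₀ φ : ℝ) : ℝ := Δ₀ * gapShape φ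

/-- Unfolding. [cite: ArmitageFournierGreene2010, §IV.A.4 p. 40] -/
theorem gap_def (Δ₀ φ : ℝ) : gap Δ₀ φ = Δ₀ * (1.43 * cos (2 * φ) - 0.43 * cos (6 * φ)) := rfl

/-- `g(0) = 1.43 − 0.43 = 1`: the coefficient `Δ₀` IS the zone-boundary (antinodal) gap — the printed
«At the zone boundary … the gap value drops to ∼ 3 meV» for the Raman set `Δ₀ = 3 meV`.
[cite: ArmitageFournierGreene2010, §IV.A.3 p. 39] -/
theorem gapShape_zero : gapShape 0 = 1 := by
  simp [gapShape]; norm_num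

/-- `Δ(0) = Δ₀`. [cite: ArmitageFournierGreene2010, §IV.A.3 p. 39] -/
theorem gap_antinode (Δ₀ : ℝ) : gap Δ₀ 0 = Δ₀ := by
  rw [gap, gapShape_zero, mul_one]

/-- The triple-angle reduction `g(φ) = cos 2φ · (2.72 − 1.72 cos² 2φ)` (`cos 6φ = 4cos³2φ − 3cos 2φ`).
[cite: ArmitageFournierGreene2010, §IV.A.4 p. 40] -/
theorem gapShape_eq_cos (φ : ℝ) :
    gapShape φ = cos (2 * φ) * (2.72 - 1.72 * cos (2 * φ) ^ 2) := by
  have h : cos (6 * φ) = 4 * cos (2 * φ) ^ 3 - 3 * cos (2 * φ) := by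
    rw [show 6 * φ = 3 * (2 * φ) by ring, Real.cos_three_mul]
  rw [gapShape, h]
  ring

/-- The node survives: `g(π/4) = 0` («zeros along the diagonal directions»).
[cite: ArmitageFournierGreene2010, §IV.A.4 p. 40] -/
theorem gapShape_node : gapShape (π / 4) = 0 := by
  rw [gapShape_eq_cos, show 2 * (π / 4) = π / 2 by ring, Real.cos_pi_div_two]
  ring

/-- `Δ(π/4) = 0`. [cite: ArmitageFournierGreene2010, §IV.A.4 p. 40] -/
theorem gap_node (Δ₀ : ℝ) : gap Δ₀ (π / 4) = 0 := by
  rw [gap, gapShape_node, mul_zero]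

/-- In the cubic variable `c = cos 2φ`: `h(c) = 2.72c − 1.72c³`.
[cite: ArmitageFournierGreene2010, §IV.A.4 p. 40] -/
def cubicShape (c : ℝ) : ℝ := 2.72 * c - 1.72 * c ^ 3

/-- Unfolding. [cite: ArmitageFournierGreene2010, §IV.A.4 p. 40] -/
theorem cubicShape_def (c : ℝ) : cubicShape c = 2.72 * c - 1.72 * c ^ 3 := rfl

/-- `g(φ) = h(cos 2φ)`. [cite: ArmitageFournierGreene2010, §IV.A.4 p. 40] -/
theorem gapShape_eq_cubicShape (φ : ℝ) : gapShape φ = cubicShape (cos (2 * φ)) := by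
  rw [gapShape_eq_cos, cubicShape]; ring

/-! ## §2 Derivative, nodal slope, critical points and the maximum -/

/-- `g′(φ) = −2.86 sin 2φ + 2.58 sin 6φ`. [cite: ArmitageFournierGreene2010, §IV.A.4 p. 40] -/
theorem hasDerivAt_gapShape (φ : ℝ) :
    HasDerivAt gapShape (-(2.86 * sin (2 * φ)) + 2.58 * sin (6 * φ)) φ := by
  have h2 : HasDerivAt (fun x : ℝ => 2 * x) 2 φ := by
    simpa using (hasDerivAt_id φ).const_mul (2 : ℝ)
  have h6 : HasDerivAt (fun x : ℝ => 6 * x) 6 φ := by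
    simpa using (hasDerivAt_id φ).const_mul (6 : ℝ)
  have hc2 := (h2.cos).const_mul (1.43 : ℝ)
  have hc6 := (h6.cos).const_mul (0.43 : ℝ)
  have h := hc2.sub hc6
  refine (h.congr_of_eventuallyEq (Filter.Eventually.of_forall fun x => by rfl)).congr_deriv ?_
  ring

/-- The derivative in the variable `s = sin 2φ`: `g′(φ) = sin 2φ · (4.88 − 10.32 sin² 2φ)`
(`sin 6φ = 3 sin 2φ − 4 sin³ 2φ`). [cite: ArmitageFournierGreene2010, §IV.A.4 p. 40] -/
theorem deriv_gapShape (φ : ℝ) :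
    deriv gapShape φ = sin (2 * φ) * (4.88 - 10.32 * sin (2 * φ) ^ 2) := by
  rw [(hasDerivAt_gapShape φ).deriv]
  have h : sin (6 * φ) = 3 * sin (2 * φ) - 4 * sin (2 * φ) ^ 3 := by
    rw [show 6 * φ = 3 * (2 * φ) by ring, Real.sin_three_mul]
  rw [h]; ring

/-- The critical points off the antinode/node lines: `g′(φ) = 0 ↔ sin 2φ = 0 ∨ sin² 2φ = 4.88/10.32`.
[cite: ArmitageFournierGreene2010, §IV.A.4 p. 40] -/
theorem deriv_gapShape_eq_zero_iff (φ : ℝ) :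
    deriv gapShape φ = 0 ↔ sin (2 * φ) = 0 ∨ sin (2 * φ) ^ 2 = 4.88 / 10.32 := by
  rw [deriv_gapShape, mul_eq_zero]
  constructor
  · rintro (h | h)
    · exact Or.inl h
    · right; linarith
  · rintro (h | h)
    · exact Or.inl h
    · right; linarith

/-- The same critical condition in the cosine: `sin² 2φ = 4.88/10.32 ↔ cos² 2φ = 2.72/5.16`
(`1 − 4.88/10.32 = 5.44/10.32 = 2.72/5.16`). [cite: ArmitageFournierGreene2010, §IV.A.4 p. 40] -/
theorem sin_sq_crit_iff_cos_sq (φ : ℝ) :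
    sin (2 * φ) ^ 2 = 4.88 / 10.32 ↔ cos (2 * φ) ^ 2 = 2.72 / 5.16 := by
  have h := Real.sin_sq_add_cos_sq (2 * φ)
  constructor <;> intro h' <;> linarith

/-- At the node the slope is `g′(π/4) = −(2·1.43 + 6·0.43) = −5.44`.
[cite: ArmitageFournierGreene2010, §IV.A.6 p. 42] -/
theorem hasDerivAt_gapShape_node : HasDerivAt gapShape (-5.44) (π / 4) := by
  have h := hasDerivAt_gapShape (π / 4)
  have hs2 : sin (2 * (π / 4)) = 1 := by
    rw [show 2 * (π / 4) = π / 2 by ring, Real.sin_pi_div_two]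
  have hs6 : sin (6 * (π / 4)) = -1 := by
    rw [show 6 * (π / 4) = 3 * (π / 2) by ring, Real.sin_three_mul, Real.sin_pi_div_two]; norm_num
  rw [hs2, hs6] at h
  refine h.congr_deriv ?_
  norm_num

/-- `Δ′(π/4) = −5.44 Δ₀` for the non-monotonic form. [cite: ArmitageFournierGreene2010, §IV.A.6 p. 42] -/
theorem hasDerivAt_gap_node (Δ₀ : ℝ) : HasDerivAt (gap Δ₀) (-(5.44 * Δ₀)) (π / 4) := by
  have h := hasDerivAt_gapShape_node.const_mul Δ₀
  refine (h.congr_of_eventuallyEq (Filter.Eventually.of_forall fun x => by rfl)).congr_deriv ?_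
  ring

/-- `|dΔ/dφ|_node = 5.44 Δ₀` (vs `2Δ₀` for `Δ₀ cos 2φ`, `abs_deriv_dWaveGap_node`).
[cite: ArmitageFournierGreene2010, §IV.A.6 p. 42] -/
theorem abs_deriv_gap_node {Δ₀ : ℝ} (h : 0 ≤ Δ₀) : |deriv (gap Δ₀) (π / 4)| = 5.44 * Δ₀ := by
  rw [(hasDerivAt_gap_node Δ₀).deriv, abs_neg, abs_of_nonneg (by positivity)]

/-- The nodal slope of the non-monotonic form is `2.72` times that of the monotonic one at the SAME
`Δ₀`. [cite: ArmitageFournierGreene2010, §IV.A.6 p. 42] -/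
theorem abs_deriv_gap_node_eq_mul {Δ₀ : ℝ} (h : 0 ≤ Δ₀) :
    |deriv (gap Δ₀) (π / 4)| = 2.72 * |deriv (dWaveGap Δ₀) (π / 4)| := by
  rw [abs_deriv_gap_node h, abs_deriv_dWaveGap_node h]; ring

/-- The global bracket of the cubic on `c ≥ −1` (so on `[−1, 1] ∋ cos 2φ`): `h(c) ≤ 1.3166`
(`1.3166 − h(c) = 1.72 (c − a)²(c + 2a) + O(10⁻⁵)` with `a = 0.72604`).
[cite: ArmitageFournierGreene2010, §IV.A.4 p. 40] -/
theorem cubicShape_le {c : ℝ} (h1 : -1 ≤ c) : cubicShape c ≤ 1.3166 := by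
  unfold cubicShape
  have hsq : 0 ≤ (c - 0.72604) ^ 2 := sq_nonneg _
  have hlin : 0 ≤ c + 1.45208 := by linarith
  nlinarith [mul_nonneg hsq hlin]

/-- Hence `g(φ) ≤ 1.3166` for every angle. [cite: ArmitageFournierGreene2010, §IV.A.4 p. 40] -/
theorem gapShape_le (φ : ℝ) : gapShape φ ≤ 1.3166 := by
  rw [gapShape_eq_cubicShape]
  exact cubicShape_le (Real.neg_one_le_cos _)

/-- The witness value: `h(0.72604) > 1.3165` (`0.72604² ≈ 2.72/5.16`).
[cite: ArmitageFournierGreene2010, §IV.A.4 p. 40] -/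
theorem cubicShape_witness : 1.3165 < cubicShape 0.72604 := by
  unfold cubicShape; norm_num

/-- The hot-spot angle `φ* = ½ arccos 0.72604` (the maximiser up to the fourth decimal of `cos 2φ*`).
[cite: ArmitageFournierGreene2010, §IV.A.3 p. 39] -/
def phiStar : ℝ := Real.arccos 0.72604 / 2

/-- Unfolding. [cite: ArmitageFournierGreene2010, §IV.A.3 p. 39] -/
theorem phiStar_def : phiStar = Real.arccos 0.72604 / 2 := rfl

/-- `cos 2φ* = 0.72604`. [cite: ArmitageFournierGreene2010, §IV.A.3 p. 39] -/
theorem cos_two_mul_phiStar : cos (2 * phiStar) = 0.72604 := by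
  rw [phiStar, show 2 * (Real.arccos 0.72604 / 2) = Real.arccos 0.72604 by ring,
    Real.cos_arccos (by norm_num) (by norm_num)]

/-- `φ*` lies strictly between the antinode and the node: `0 < φ* < π/4`.
[cite: ArmitageFournierGreene2010, §IV.A.3 p. 39] -/
theorem phiStar_mem : 0 < phiStar ∧ phiStar < π / 4 := by
  have h1 : 0 < Real.arccos 0.72604 := Real.arccos_pos.mpr (by norm_num)
  have h2 : Real.arccos 0.72604 < π / 2 := Real.arccos_lt_pi_div_two.mpr (by norm_num)
  unfold phiStar
  constructor <;> linarith

/-- `g(φ*) > 1.3165`. [cite: ArmitageFournierGreene2010, §IV.A.4 p. 40] -/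
theorem gapShape_phiStar : 1.3165 < gapShape phiStar := by
  rw [gapShape_eq_cubicShape, cos_two_mul_phiStar]
  exact cubicShape_witness

/-- THE MAXIMUM BRACKET: `1.3165 < sup g ≤ 1.3166`, attained near the hot spot, i.e.
`Δ_max = g_max Δ₀` with `g_max ∈ (1.3165, 1.3166]`. [cite: ArmitageFournierGreene2010, §IV.A.4 p. 40] -/
theorem gapShape_max_bracket :
    (∀ φ, gapShape φ ≤ 1.3166) ∧ ∃ φ, 0 < φ ∧ φ < π / 4 ∧ 1.3165 < gapShape φ :=
  ⟨gapShape_le, phiStar, phiStar_mem.1, phiStar_mem.2, gapShape_phiStar⟩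

/-- `Δ(φ) ≤ 1.3166 Δ₀` for `Δ₀ ≥ 0`. [cite: ArmitageFournierGreene2010, §IV.A.4 p. 40] -/
theorem gap_le {Δ₀ : ℝ} (h : 0 ≤ Δ₀) (φ : ℝ) : gap Δ₀ φ ≤ 1.3166 * Δ₀ := by
  calc gap Δ₀ φ = gapShape φ * Δ₀ := by rw [gap, mul_comm]
    _ ≤ 1.3166 * Δ₀ := mul_le_mul_of_nonneg_right (gapShape_le φ) h

/-- `Δ(φ*) > 1.3165 Δ₀` for `Δ₀ > 0`. [cite: ArmitageFournierGreene2010, §IV.A.4 p. 40] -/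
theorem gap_phiStar {Δ₀ : ℝ} (h : 0 < Δ₀) : 1.3165 * Δ₀ < gap Δ₀ phiStar := by
  calc 1.3165 * Δ₀ < gapShape phiStar * Δ₀ := mul_lt_mul_of_pos_right gapShape_phiStar h
    _ = gap Δ₀ phiStar := by rw [gap, mul_comm]

/-! ## §3 The printed rows: both maxima from one form, and the transport pair `96 → 47`, `0.96 → 0.47` -/

/-- ARPES (Matsui 2005, PLCCO `x = 0.11`): `Δ₀ = 1.9 meV` ⇒ `Δ_max ∈ (2.501, 2.502) meV` — the printed
«∆max ∼ 2.5 meV»; and `Δ(ZB) = 1.9`. [cite: ArmitageFournierGreene2010, §IV.A.4 p. 40] -/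
theorem matsui2005_row :
    (∀ φ, gap 1.9 φ ≤ 2.502) ∧ 2.501 < gap 1.9 phiStar ∧ gap 1.9 0 = 1.9 := by
  refine ⟨fun φ => ?_, ?_, gap_antinode 1.9⟩
  · have := gap_le (Δ₀ := 1.9) (by norm_num) φ; linarith
  · have := gap_phiStar (Δ₀ := 1.9) (by norm_num); linarith

/-- Raman (Blumberg 2002 / Qazilbash 2005, NCCO): `Δ₀ = 3 meV` ⇒ `Δ_max ∈ (3.949, 3.950) meV` — the
printed «∆max ∼ 4 meV» at the hot spot — and `Δ(ZB) = 3` («drops to ∼ 3 meV»).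
[cite: ArmitageFournierGreene2010, §IV.A.3 p. 39] -/
theorem blumberg2002_row :
    (∀ φ, gap 3 φ ≤ 3.950) ∧ 3.949 < gap 3 phiStar ∧ gap 3 0 = 3 := by
  refine ⟨fun φ => ?_, ?_, gap_antinode 3⟩
  · have := gap_le (Δ₀ := 3) (by norm_num) φ; linarith
  · have := gap_phiStar (Δ₀ := 3) (by norm_num); linarith

/-- The gap velocity `v₂ = |dΔ/dφ|_node/(ħk_F)` of the non-monotonic `Δ₀ = 3` form is `2.04` times
that of the monotonic `Δ₀ = 4` form: `(5.44·3)/(2·4) = 2.04` (same `ħ`, `k_F`).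
[cite: ArmitageFournierGreene2010, §IV.A.6 p. 42] -/
theorem gapVelocity_ratio {hbar kF : ℝ} (hh : hbar ≠ 0) (hk : kF ≠ 0) :
    gapVelocity hbar kF |deriv (gap 3) (π / 4)| / gapVelocity hbar kF |deriv (dWaveGap 4) (π / 4)|
      = 2.04 := by
  rw [abs_deriv_gap_node (by norm_num), abs_deriv_dWaveGap_node (by norm_num)]
  unfold gapVelocity
  field_simp
  norm_num

/-- Hence the velocity ratio: `v_F/v₂ = 96 ↦ 96/2.04 ∈ (47.05, 47.06)` — the printed «∼ 47».
[cite: ArmitageFournierGreene2010, §IV.A.6 p. 42] -/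
theorem velocityRatio_row : 47.05 < (96 : ℝ) / 2.04 ∧ (96 : ℝ) / 2.04 < 47.06 := by norm_num

/-- … and the heat-conduction image `κ_el/T ∝ A(r) = r + 1/r` (`anisotropySum`):
`0.96 · A(96/2.04)/A(96) ∈ (0.470, 0.471) mW K⁻² cm⁻¹` — the printed «κ_el/T ≈ 0.47» from «0.96».
[cite: ArmitageFournierGreene2010, §IV.A.6 p. 42] -/
theorem kappaRatio_row :
    0.470 < 0.96 * anisotropySum (96 / 2.04) / anisotropySum 96 ∧
      0.96 * anisotropySum (96 / 2.04) / anisotropySum 96 < 0.471 := by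
  simp only [anisotropySum]
  constructor <;> norm_num

/-- The measured `κ_el/T ≈ 0.60` (Taillefer, as quoted) lies strictly between the two estimates
`0.47 < 0.60 < 0.96`. [cite: ArmitageFournierGreene2010, §IV.A.6 p. 42] -/
theorem taillefer_between : (0.47 : ℝ) < 0.60 ∧ (0.60 : ℝ) < 0.96 := by norm_num

/-! ## §4 The SC gap BY PROBE as `2Δ/k_BT_c` arithmetic -/

/-- STM (Niestemski 2007, PLCCO `x = 0.12`, `T_c = 24 K`): the average `7.2 meV` maps to
`2Δ/k_BT_c ∈ (6.96, 6.97)` at the printed `T_c` (the text prints «7.5»); the typical `6.5 / 7.0 meV`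
map to `(6.28, 6.29) / (6.76, 6.77)`; a ratio of exactly `7.5` at `24 K` needs
`Δ = 7.5 k_B · 24/2 ∈ (7.755, 7.757) meV`. [cite: ArmitageFournierGreene2010, §III.B p. 24] -/
theorem niestemski2007_rows :
    (6.96 < tunnellingGapRatio 7.2 24 ∧ tunnellingGapRatio 7.2 24 < 6.97) ∧
    (6.28 < tunnellingGapRatio 6.5 24 ∧ tunnellingGapRatio 6.5 24 < 6.29) ∧
    (6.76 < tunnellingGapRatio 7.0 24 ∧ tunnellingGapRatio 7.0 24 < 6.77) ∧
    (7.755 < 7.5 * kBmeVPerKelvin * 24 / 2 ∧ 7.5 * kBmeVPerKelvin * 24 / 2 < 7.757) := by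
  refine ⟨⟨?_, ?_⟩, ⟨?_, ?_⟩, ⟨?_, ?_⟩, ⟨?_, ?_⟩⟩ <;>
    norm_num [tunnellingGapRatio, kBmeVPerKelvin, boltzmannSI, elementaryChargeSI_def]

/-- The STM mean with its bar, `7.2 ± 1.2 meV` at `24 K`: `2Δ/k_BT_c ∈ (5.80, 8.13)`; the printed
`7.5` is inside the bar, the PC/SIS/Raman `3.5` is not. [cite: ArmitageFournierGreene2010, §III.B p. 24] -/
theorem niestemski2007_bar :
    5.80 < tunnellingGapRatio (7.2 - 1.2) 24 ∧ tunnellingGapRatio (7.2 + 1.2) 24 < 8.13 ∧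
    tunnellingGapRatio (7.2 - 1.2) 24 < 7.5 ∧ 3.5 < tunnellingGapRatio (7.2 - 1.2) 24 := by
  refine ⟨?_, ?_, ?_, ?_⟩ <;>
    norm_num [tunnellingGapRatio, kBmeVPerKelvin, boltzmannSI, elementaryChargeSI_def]

/-- Optics (Homes 2006, Pr₁.₈₅Ce₀.₁₅CuO₄ film): `35 cm⁻¹ ∈ (4.339, 4.340) meV` (printed «4.3 meV»), and
a ratio of `5` at `Δ₀ = 4.3 meV` corresponds to `T_c = 2·4.3/(5k_B) ∈ (19.9, 20.0) K`.
[cite: ArmitageFournierGreene2010, §III.D p. 30] -/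
theorem homes2006_rows :
    (4.339 < invCmToMeV 35 ∧ invCmToMeV 35 < 4.340) ∧
    (19.9 < 2 * 4.3 / (5 * kBmeVPerKelvin) ∧ 2 * 4.3 / (5 * kBmeVPerKelvin) < 20.0) := by
  refine ⟨⟨?_, ?_⟩, ⟨?_, ?_⟩⟩ <;>
    norm_num [invCmToMeV, invCmPerMeV, kBmeVPerKelvin, boltzmannSI, speedOfLightSI, planckSI_def,
      elementaryChargeSI_def]

/-- At that `T_c ≈ 20 K` the optics ratio is what `tunnellingGapRatio` returns: `2·4.3/(k_B·20) ∈
(4.98, 5.0)`. [cite: ArmitageFournierGreene2010, §III.D p. 30] -/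
theorem homes2006_ratio_at20 : 4.98 < tunnellingGapRatio 4.3 20 ∧ tunnellingGapRatio 4.3 20 < 5.0 := by
  constructor <;> norm_num [tunnellingGapRatio, kBmeVPerKelvin, boltzmannSI, elementaryChargeSI_def]

/-- NMR (Zheng 2003, PLCCO `x = 0.09`): «2∆₀ = 3.8 k_BT_c» ⇒ `Δ₀/T_c = 1.9 k_B ∈ (0.1637, 0.1638) meV/K`
(no `T_c` assumed). [cite: ArmitageFournierGreene2010, §IV.A.7 p. 43] -/
theorem zheng2003_row : 0.1637 < 1.9 * kBmeVPerKelvin ∧ 1.9 * kBmeVPerKelvin < 0.1638 := by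
  constructor <;> norm_num [kBmeVPerKelvin, boltzmannSI, elementaryChargeSI_def]

/-- The by-probe ratios as printed are pairwise distinct and span a factor `> 3`:
`2 < 3 < 3.5 < 3.8 < 5 < 7.5`, `7.5/2 > 3`. [cite: ArmitageFournierGreene2010, §IV.A pp. 37–43] -/
theorem byProbe_ratios_ordered :
    (2 : ℝ) < 3 ∧ (3 : ℝ) < 3.5 ∧ (3.5 : ℝ) < 3.8 ∧ (3.8 : ℝ) < 5 ∧ (5 : ℝ) < 7.5 ∧ 3 < (7.5 : ℝ) / 2 := by
  norm_num

/-! ## §5 [Motoyama 2007] the thermal length and the `ξ*` fit -/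

/-- The single-particle thermal de Broglie length in units of the planar lattice constant, times `T`:
`ξ_th T/a = ħ v_F/(π k_B a)` [K] for `v_F` in m/s and `a` in m.
[cite: MotoyamaEtAl2007NCCOSpinCorrelations, p. 4] -/
def thermalLengthK (vF a : ℝ) : ℝ := hbarSI * vF / (π * boltzmannSI * a)

/-- Unfolding. [cite: MotoyamaEtAl2007NCCOSpinCorrelations, p. 4] -/
theorem thermalLengthK_def (vF a : ℝ) : thermalLengthK vF a = hbarSI * vF / (π * boltzmannSI * a) := rfl

/-- `ħ v_F/(π k_B a) = h v_F/(2 k_B a)/π²`. [cite: MotoyamaEtAl2007NCCOSpinCorrelations, p. 4] -/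
theorem thermalLengthK_eq (vF a : ℝ) (ha : a ≠ 0) :
    thermalLengthK vF a = planckSI * vF / (2 * boltzmannSI * a) / π ^ 2 := by
  unfold thermalLengthK hbarSI
  have hπ : (π : ℝ) ≠ 0 := Real.pi_ne_zero
  have hk : boltzmannSI ≠ 0 := by norm_num [boltzmannSI]
  field_simp

/-- At the printed `v_F = 2.2 × 10⁷ cm/s = 2.2 × 10⁵ m/s` and `a = 3.95 Å`:
`ξ_th T/a ∈ (1354.1, 1354.2) K`. [cite: MotoyamaEtAl2007NCCOSpinCorrelations, p. 4] -/
theorem thermalLengthK_ncco : 1354.1 < thermalLengthK 2.2e5 3.95e-10 ∧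
    thermalLengthK 2.2e5 3.95e-10 < 1354.2 := by
  rw [thermalLengthK_eq _ _ (by norm_num), planckSI_def, boltzmannSI_def]
  have hπ : (0 : ℝ) < π ^ 2 := by positivity
  have h1 := Real.pi_gt_d6
  have h2 := Real.pi_lt_d6
  constructor
  · rw [lt_div_iff₀ hπ]
    norm_num
    nlinarith
  · rw [div_lt_iff₀ hπ]
    norm_num
    nlinarith

/-- The printed fit along `T*`: `ξ*/a = C/(x_c − x)`. [cite: MotoyamaEtAl2007NCCOSpinCorrelations, Eq. 2] -/
def xiStarOverA (C xc x : ℝ) : ℝ := C / (xc - x)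

/-- Unfolding. [cite: MotoyamaEtAl2007NCCOSpinCorrelations, Eq. 2] -/
theorem xiStarOverA_def (C xc x : ℝ) : xiStarOverA C xc x = C / (xc - x) := rfl

/-- Rows at the printed central fit `C = 0.96`, `x_c = 0.171`: `x = 0.100 ↦ (13.52, 13.53)` (M55),
`0.125 ↦ (20.86, 20.87)`, `0.134 ↦ (25.94, 25.95)`, `0.140 ↦ (30.96, 30.97)`, `0.145 ↦ (36.92, 36.93)`,
`0.150 ↦ (45.71, 45.72)` (M20; where the fit is printed to break down).
[cite: MotoyamaEtAl2007NCCOSpinCorrelations, Eq. 2 and Fig. 4c] -/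
theorem motoyama2007_xi_rows :
    (13.52 < xiStarOverA 0.96 0.171 0.100 ∧ xiStarOverA 0.96 0.171 0.100 < 13.53) ∧
    (20.86 < xiStarOverA 0.96 0.171 0.125 ∧ xiStarOverA 0.96 0.171 0.125 < 20.87) ∧
    (25.94 < xiStarOverA 0.96 0.171 0.134 ∧ xiStarOverA 0.96 0.171 0.134 < 25.95) ∧
    (30.96 < xiStarOverA 0.96 0.171 0.140 ∧ xiStarOverA 0.96 0.171 0.140 < 30.97) ∧
    (36.92 < xiStarOverA 0.96 0.171 0.145 ∧ xiStarOverA 0.96 0.171 0.145 < 36.93) ∧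
    (45.71 < xiStarOverA 0.96 0.171 0.150 ∧ xiStarOverA 0.96 0.171 0.150 < 45.72) := by
  refine ⟨⟨?_, ?_⟩, ⟨?_, ?_⟩, ⟨?_, ?_⟩, ⟨?_, ?_⟩, ⟨?_, ?_⟩, ⟨?_, ?_⟩⟩ <;> norm_num [xiStarOverA]

/-- `ξ*/a` is strictly increasing in `x` below `x_c` (for `C > 0`).
[cite: MotoyamaEtAl2007NCCOSpinCorrelations, Fig. 4c] -/
theorem xiStarOverA_lt {C xc x y : ℝ} (hC : 0 < C) (hxy : x < y) (hy : y < xc) :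
    xiStarOverA C xc x < xiStarOverA C xc y := by
  unfold xiStarOverA
  exact div_lt_div_of_pos_left hC (by linarith) (by linarith)

/-- Monotonicity in the fit parameters: larger `C` and smaller `x_c` increase `ξ*/a` (for `x < x_c`).
[cite: MotoyamaEtAl2007NCCOSpinCorrelations, Eq. 2] -/
theorem xiStarOverA_mono {C C' xc xc' x : ℝ} (hC : 0 ≤ C) (hCC : C ≤ C') (hx : x < xc') (hxc : xc' ≤ xc) :
    xiStarOverA C xc x ≤ xiStarOverA C' xc' x := by
  unfold xiStarOverA
  have h1 : 0 < xc' - x := by linarith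
  have h2 : xc' - x ≤ xc - x := by linarith
  calc C / (xc - x) ≤ C / (xc' - x) := div_le_div_of_nonneg_left hC h1 h2
    _ ≤ C' / (xc' - x) := div_le_div_of_nonneg_right hCC h1.le

/-- The corner bracket at `x = 0.10` (M55) from the printed bars `C = 0.96 ± 0.12`, `x_c = 0.171 ± 0.004`:
every `(C, x_c) ∈ [0.84, 1.08] × [0.167, 0.175]` gives `ξ*/a ∈ [11.2, 16.12)`.
[cite: MotoyamaEtAl2007NCCOSpinCorrelations, Eq. 2] -/
theorem motoyama2007_x010_bar {C xc : ℝ} (hC1 : 0.84 ≤ C) (hC2 : C ≤ 1.08) (hx1 : 0.167 ≤ xc)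
    (hx2 : xc ≤ 0.175) : 11.2 ≤ xiStarOverA C xc 0.100 ∧ xiStarOverA C xc 0.100 < 16.12 := by
  have hlo := xiStarOverA_mono (C := 0.84) (C' := C) (xc := 0.175) (xc' := xc) (x := 0.100)
    (by norm_num) hC1 (by linarith) hx2
  have hhi := xiStarOverA_mono (C := C) (C' := 1.08) (xc := xc) (xc' := 0.167) (x := 0.100)
    (by linarith) hC2 (by norm_num) hx1
  have h1 : (11.2 : ℝ) ≤ xiStarOverA 0.84 0.175 0.100 := by norm_num [xiStarOverA]
  have h2 : xiStarOverA 1.08 0.167 0.100 < 16.12 := by norm_num [xiStarOverA]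
  exact ⟨le_trans h1 hlo, lt_of_le_of_lt hhi h2⟩

/-- The printed breakdown near optimal doping: Eq. 2 at `x = 0.15` would give `ξ*/a > 45`, three times
the printed `ξ* ≈ ξ₀ ≈ ξ_SC = 58 Å ≈ 15a` (`58/3.95 ∈ (14.68, 14.69)`); the printed mean free paths
`ℓ(T*) ≈ 2.4a` (`x = 0.125`) and `≈ 25a` (`x = 0.15`) sit below the Eq.-2 values.
[cite: MotoyamaEtAl2007NCCOSpinCorrelations, p. 4] -/
theorem motoyama2007_breakdown :
    (14.68 < (58 : ℝ) / 3.95 ∧ (58 : ℝ) / 3.95 < 14.69) ∧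
    3 * ((58 : ℝ) / 3.95) < xiStarOverA 0.96 0.171 0.150 ∧
    (2.4 : ℝ) < xiStarOverA 0.96 0.171 0.125 ∧ (25 : ℝ) < xiStarOverA 0.96 0.171 0.150 := by
  refine ⟨⟨?_, ?_⟩, ?_, ?_, ?_⟩ <;> norm_num [xiStarOverA]

/-- The printed end points side by side: the long-range AF boundary `x_AF = 0.134 ± 0.004` lies
strictly below the `ξ*` divergence point `x_c = 0.171 ± 0.004` (bars disjoint: `0.138 < 0.167`), and
M55 (`0.10`) / M20 (`0.15`) sit on either side of `x_AF`.
[cite: MotoyamaEtAl2007NCCOSpinCorrelations, p. 4] -/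
theorem motoyama2007_endpoints :
    (0.134 : ℝ) + 0.004 < 0.171 - 0.004 ∧ (0.10 : ℝ) < 0.134 - 0.004 ∧ (0.134 : ℝ) + 0.004 < 0.15 := by
  norm_num

/-! ## §6 The composed crossover temperature `T*(x)` (DERIVED) and the GL image of `ξ_SC` -/

/-- `ξ* = 2.6 ξ_th` and `ξ*/a = C/(x_c − x)` combine to `T*(x) = 2.6 (ξ_th T/a)(x_c − x)/C`
(DERIVED from the two printed fits; value-free). [cite: MotoyamaEtAl2007NCCOSpinCorrelations, p. 4] -/
def tStar (C xc x : ℝ) : ℝ := 2.6 * thermalLengthK 2.2e5 3.95e-10 / xiStarOverA C xc x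

/-- Unfolding. [cite: MotoyamaEtAl2007NCCOSpinCorrelations, p. 4] -/
theorem tStar_def (C xc x : ℝ) :
    tStar C xc x = 2.6 * thermalLengthK 2.2e5 3.95e-10 / xiStarOverA C xc x := rfl

/-- At `T = T*(x)` the thermal length times `2.6` equals the fitted `ξ*`: `2.6 ξ_th(T*)/a = C/(x_c − x)`
(for `x < x_c`, `C > 0`). [cite: MotoyamaEtAl2007NCCOSpinCorrelations, p. 4] -/
theorem tStar_spec {C xc x : ℝ} (hC : 0 < C) (hx : x < xc) :
    2.6 * thermalLengthK 2.2e5 3.95e-10 / tStar C xc x = xiStarOverA C xc x := by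
  have hL : 0 < thermalLengthK 2.2e5 3.95e-10 := lt_trans (by norm_num) thermalLengthK_ncco.1
  have hξ : 0 < xiStarOverA C xc x := by unfold xiStarOverA; exact div_pos hC (by linarith)
  unfold tStar
  field_simp

/-- DERIVED rows at the central fit: `T*(0.100) ∈ (260, 261)` (M55), `T*(0.125) ∈ (168, 169)`,
`T*(0.134) ∈ (135, 136)`, `T*(0.140) ∈ (113, 114)`, `T*(0.145) ∈ (95, 96)`, `T*(0.150) ∈ (77, 77.1)` K
(M20; cf. the «∼ 80–170 K» pseudogap onset quoted at `x = 0.14–0.15`).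
[cite: MotoyamaEtAl2007NCCOSpinCorrelations, Fig. 1 and p. 4] -/
theorem motoyama2007_tStar_rows :
    (260 < tStar 0.96 0.171 0.100 ∧ tStar 0.96 0.171 0.100 < 261) ∧
    (168 < tStar 0.96 0.171 0.125 ∧ tStar 0.96 0.171 0.125 < 169) ∧
    (135 < tStar 0.96 0.171 0.134 ∧ tStar 0.96 0.171 0.134 < 136) ∧
    (113 < tStar 0.96 0.171 0.140 ∧ tStar 0.96 0.171 0.140 < 114) ∧
    (95 < tStar 0.96 0.171 0.145 ∧ tStar 0.96 0.171 0.145 < 96) ∧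
    (77 < tStar 0.96 0.171 0.150 ∧ tStar 0.96 0.171 0.150 < 77.1) := by
  obtain ⟨h1, h2⟩ := thermalLengthK_ncco
  simp only [tStar, xiStarOverA]
  refine ⟨⟨?_, ?_⟩, ⟨?_, ?_⟩, ⟨?_, ?_⟩, ⟨?_, ?_⟩, ⟨?_, ?_⟩, ⟨?_, ?_⟩⟩
  all_goals first
    | (rw [lt_div_iff₀ (by norm_num)]; nlinarith)
    | (rw [div_lt_iff₀ (by norm_num)]; nlinarith)

/-- `T*(x)` is AFFINE and strictly decreasing in `x`: `T*(x) = (2.6 ξ_th T/a / C)(x_c − x)`, slope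
`−2.6·(ξ_th T/a)/C ∈ (−3668, −3667) K` per unit `x` at `C = 0.96` — the printed «approximately linear
relationship T* ∝ (x* − x)». [cite: MotoyamaEtAl2007NCCOSpinCorrelations, p. 4] -/
theorem tStar_affine (C xc x : ℝ) :
    tStar C xc x = 2.6 * thermalLengthK 2.2e5 3.95e-10 / C * (xc - x) := by
  unfold tStar xiStarOverA
  rw [div_div_eq_mul_div]
  ring

/-- The slope bracket at `C = 0.96`. [cite: MotoyamaEtAl2007NCCOSpinCorrelations, p. 4] -/
theorem tStar_slope : 3667 < 2.6 * thermalLengthK 2.2e5 3.95e-10 / 0.96 ∧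
    2.6 * thermalLengthK 2.2e5 3.95e-10 / 0.96 < 3668 := by
  obtain ⟨h1, h2⟩ := thermalLengthK_ncco
  constructor
  · rw [lt_div_iff₀ (by norm_num)]; nlinarith
  · rw [div_lt_iff₀ (by norm_num)]; nlinarith

/-- The GL orbital image of the printed `ξ_SC = 58 Å = 5.8 nm`: `Φ₀/(2πξ²) ∈ (9.78, 9.79) T` — next to
the «H_c2 ∼ 10 T at 0 K» quoted for NCCO (a by-source member of REFVALS-2 §57.10, not a ruling).
[cite: MotoyamaEtAl2007NCCOSpinCorrelations, p. 4] -/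
theorem xiSC_GL_image : 9.78 < bGL 5.8 ∧ bGL 5.8 < 9.79 := by
  have h := bGL_point (ξ := 5.8) (by norm_num)
  exact ⟨lt_of_le_of_lt (by norm_num) h.1, lt_of_lt_of_le h.2 (by norm_num)⟩

/-! ## §7 Onose's optical pseudogap rule `Δ_pg = 10 k_B T*` -/

/-- `T* = Δ_pg/(10 k_B)` for `Δ_pg` in meV (the printed «∆pg = 10k_BT∗»).
[cite: ArmitageFournierGreene2010, §III.D p. 28] -/
def onoseTStar (ΔpgMeV : ℝ) : ℝ := ΔpgMeV / (10 * kBmeVPerKelvin)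

/-- Unfolding. [cite: ArmitageFournierGreene2010, §III.D p. 28] -/
theorem onoseTStar_def (Δ : ℝ) : onoseTStar Δ = Δ / (10 * kBmeVPerKelvin) := rfl

/-- The printed range `Δ_pg = 0.2–0.4 eV` ↦ `T* ∈ (232.0, 232.2) / (348.1, 348.2) / (464.1, 464.3) K`
at `0.2 / 0.3 / 0.4 eV`. [cite: ArmitageFournierGreene2010, §III.D p. 28] -/
theorem onose_rows :
    (232.0 < onoseTStar 200 ∧ onoseTStar 200 < 232.2) ∧
    (348.1 < onoseTStar 300 ∧ onoseTStar 300 < 348.2) ∧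
    (464.1 < onoseTStar 400 ∧ onoseTStar 400 < 464.3) := by
  refine ⟨⟨?_, ?_⟩, ⟨?_, ?_⟩, ⟨?_, ?_⟩⟩ <;>
    norm_num [onoseTStar, kBmeVPerKelvin, boltzmannSI, elementaryChargeSI_def]

/-- Read the other way at M55's DERIVED `T*(0.10) ∈ (260, 261) K`: `Δ_pg = 10 k_B T* ∈ (224, 225) meV`
— inside the printed `0.2–0.4 eV`. [cite: ArmitageFournierGreene2010, §III.D p. 28] -/
theorem onose_at_M55 : 224 < 10 * kBmeVPerKelvin * tStar 0.96 0.171 0.100 ∧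
    10 * kBmeVPerKelvin * tStar 0.96 0.171 0.100 < 225 := by
  obtain ⟨h1, h2⟩ := motoyama2007_tStar_rows.1
  obtain ⟨k1, k2⟩ := kBmeVPerKelvin_bounds
  constructor <;> nlinarith


/-! ## §8 (appended) The harmonic family `B cos 2φ + (1 − B) cos 6φ` by material, and the §148 rows -/

/-- The one-parameter harmonic d-wave family `h_B(φ) = B cos 2φ + (1 − B) cos 6φ` («a cos(6φ) second
order harmonics term in the d_{x²−y²}-wave»). [cite: KondoEtAl2007Bi2201TwoEnergyScales, p. 3] -/
def harmonicDWave (B φ : ℝ) : ℝ := B * cos (2 * φ) + (1 - B) * cos (6 * φ)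

/-- Unfolding. [cite: KondoEtAl2007Bi2201TwoEnergyScales, p. 3] -/
theorem harmonicDWave_def (B φ : ℝ) : harmonicDWave B φ = B * cos (2 * φ) + (1 - B) * cos (6 * φ) := rfl

/-- The electron-doped form of §1 is the member `B = 1.43` (`1 − 1.43 = −0.43`).
[cite: ArmitageFournierGreene2010, §IV.A.4 p. 40] -/
theorem gapShape_eq_harmonicDWave (φ : ℝ) : gapShape φ = harmonicDWave 1.43 φ := by
  simp only [gapShape, harmonicDWave]; ring

/-- `B = 1` is the pure `cos 2φ` d-wave. [cite: KondoEtAl2007Bi2201TwoEnergyScales, p. 3] -/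
theorem harmonicDWave_one (φ : ℝ) : harmonicDWave 1 φ = cos (2 * φ) := by
  simp [harmonicDWave]

/-- `h_B(0) = 1` for every `B`: `Δ₀` is always the antinodal value.
[cite: KondoEtAl2007Bi2201TwoEnergyScales, p. 3] -/
theorem harmonicDWave_antinode (B : ℝ) : harmonicDWave B 0 = 1 := by
  simp [harmonicDWave]

/-- The triple-angle reduction `h_B(φ) = cos 2φ · ((4B − 3) + 4(1 − B) cos² 2φ)`.
[cite: KondoEtAl2007Bi2201TwoEnergyScales, p. 3] -/
theorem harmonicDWave_eq_cos (B φ : ℝ) :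
    harmonicDWave B φ = cos (2 * φ) * ((4 * B - 3) + 4 * (1 - B) * cos (2 * φ) ^ 2) := by
  have h : cos (6 * φ) = 4 * cos (2 * φ) ^ 3 - 3 * cos (2 * φ) := by
    rw [show 6 * φ = 3 * (2 * φ) by ring, Real.cos_three_mul]
  rw [harmonicDWave, h]
  ring

/-- The node survives for every `B`: `h_B(π/4) = 0`. [cite: KondoEtAl2007Bi2201TwoEnergyScales, p. 3] -/
theorem harmonicDWave_node (B : ℝ) : harmonicDWave B (π / 4) = 0 := by
  rw [harmonicDWave_eq_cos, show 2 * (π / 4) = π / 2 by ring, Real.cos_pi_div_two]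
  ring

/-- `h_B′(φ) = −2B sin 2φ − 6(1 − B) sin 6φ`. [cite: KondoEtAl2007Bi2201TwoEnergyScales, p. 3] -/
theorem hasDerivAt_harmonicDWave (B φ : ℝ) :
    HasDerivAt (harmonicDWave B) (-(2 * B * sin (2 * φ)) - 6 * (1 - B) * sin (6 * φ)) φ := by
  have h2 : HasDerivAt (fun x : ℝ => 2 * x) 2 φ := by
    simpa using (hasDerivAt_id φ).const_mul (2 : ℝ)
  have h6 : HasDerivAt (fun x : ℝ => 6 * x) 6 φ := by
    simpa using (hasDerivAt_id φ).const_mul (6 : ℝ)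
  have hc2 := (h2.cos).const_mul B
  have hc6 := (h6.cos).const_mul (1 - B)
  have h := hc2.add hc6
  refine (h.congr_of_eventuallyEq (Filter.Eventually.of_forall fun x => by rfl)).congr_deriv ?_
  ring

/-- THE NODAL SLOPE BY `B`: `h_B′(π/4) = −(8B − 6)` (`sin(π/2) = 1`, `sin(3π/2) = −1`).
[cite: KondoEtAl2007Bi2201TwoEnergyScales, p. 3] -/
theorem hasDerivAt_harmonicDWave_node (B : ℝ) : HasDerivAt (harmonicDWave B) (-(8 * B - 6)) (π / 4) := by
  have h := hasDerivAt_harmonicDWave B (π / 4)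
  have hs2 : sin (2 * (π / 4)) = 1 := by
    rw [show 2 * (π / 4) = π / 2 by ring, Real.sin_pi_div_two]
  have hs6 : sin (6 * (π / 4)) = -1 := by
    rw [show 6 * (π / 4) = 3 * (π / 2) by ring, Real.sin_three_mul, Real.sin_pi_div_two]; norm_num
  rw [hs2, hs6] at h
  refine h.congr_deriv ?_
  ring

/-- `deriv h_B (π/4) = −(8B − 6)`. [cite: KondoEtAl2007Bi2201TwoEnergyScales, p. 3] -/
theorem deriv_harmonicDWave_node (B : ℝ) : deriv (harmonicDWave B) (π / 4) = -(8 * B - 6) :=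
  (hasDerivAt_harmonicDWave_node B).deriv

/-- The nodal slope relative to the pure d-wave slope `2` is `4B − 3`.
[cite: KondoEtAl2007Bi2201TwoEnergyScales, p. 3] -/
theorem nodalSlope_ratio (B : ℝ) : (8 * B - 6) / 2 = 4 * B - 3 := by ring

/-- Rows BY MATERIAL: `B = 0.78` (optimally doped (Bi,Pb)₂(Sr,La)₂CuO₆₊δ) ↦ slope `0.24` (`× 0.12`);
`B = 0.88` (underdoped Bi-2212, `T_c = 75 K`) ↦ `1.04` (`× 0.52`); `B = 1` ↦ `2`; `B = 1.43`
(electron-doped, §1) ↦ `5.44` (`× 2.72`). [cite: KondoEtAl2007Bi2201TwoEnergyScales, p. 3] -/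
theorem nodalSlope_rows :
    (8 * (0.78 : ℝ) - 6 = 0.24 ∧ 4 * (0.78 : ℝ) - 3 = 0.12) ∧
    (8 * (0.88 : ℝ) - 6 = 1.04 ∧ 4 * (0.88 : ℝ) - 3 = 0.52) ∧
    (8 * (1 : ℝ) - 6 = 2) ∧ (8 * (1.43 : ℝ) - 6 = 5.44 ∧ 4 * (1.43 : ℝ) - 3 = 2.72) := by
  norm_num

/-- The nodal slope is strictly increasing in `B`. [cite: KondoEtAl2007Bi2201TwoEnergyScales, p. 3] -/
theorem nodalSlope_strictMono : StrictMono (fun B : ℝ => 8 * B - 6) := by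
  intro a b hab; dsimp; linarith

/-- For `3/4 ≤ B ≤ 1` the harmonic form never exceeds the pure d-wave in magnitude: `|h_B(φ)| ≤ |cos 2φ|`
(the bracket `(4B − 3) + 4(1 − B)cos² 2φ ∈ [0, 1]`); so a `B < 1` harmonic keeps the maximum at the
antinode (`= 1`) while flattening the node. [cite: KondoEtAl2007Bi2201TwoEnergyScales, p. 3] -/
theorem abs_harmonicDWave_le {B : ℝ} (hB1 : 3 / 4 ≤ B) (hB2 : B ≤ 1) (φ : ℝ) :
    |harmonicDWave B φ| ≤ |cos (2 * φ)| := by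
  rw [harmonicDWave_eq_cos, abs_mul]
  have hc2 : cos (2 * φ) ^ 2 ≤ 1 := by
    have h1 := Real.neg_one_le_cos (2 * φ)
    have h2 := Real.cos_le_one (2 * φ)
    nlinarith
  have hlo : 0 ≤ (4 * B - 3) + 4 * (1 - B) * cos (2 * φ) ^ 2 := by
    have : 0 ≤ 4 * (1 - B) * cos (2 * φ) ^ 2 := by
      apply mul_nonneg (by linarith) (sq_nonneg _)
    linarith
  have hhi : (4 * B - 3) + 4 * (1 - B) * cos (2 * φ) ^ 2 ≤ 1 := by
    have : 4 * (1 - B) * cos (2 * φ) ^ 2 ≤ 4 * (1 - B) * 1 :=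
      mul_le_mul_of_nonneg_left hc2 (by linarith)
    linarith
  calc |cos (2 * φ)| * |(4 * B - 3) + 4 * (1 - B) * cos (2 * φ) ^ 2|
      ≤ |cos (2 * φ)| * 1 := by
        apply mul_le_mul_of_nonneg_left _ (abs_nonneg _)
        rw [abs_le]; constructor <;> linarith
    _ = |cos (2 * φ)| := mul_one _

/-- In particular `|h_B| ≤ 1 = h_B(0)` for `3/4 ≤ B ≤ 1` — contrast `B = 1.43`, whose maximum
`∈ (1.3165, 1.3166]` sits inside (§2). [cite: KondoEtAl2007Bi2201TwoEnergyScales, p. 3] -/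
theorem abs_harmonicDWave_le_one {B : ℝ} (hB1 : 3 / 4 ≤ B) (hB2 : B ≤ 1) (φ : ℝ) :
    |harmonicDWave B φ| ≤ harmonicDWave B 0 := by
  rw [harmonicDWave_antinode]
  exact le_trans (abs_harmonicDWave_le hB1 hB2 φ) (Real.abs_cos_le_one _)

/-- The printed weak-coupling d-wave rule «2Δ/k_BT = 4.3» read as the map `T ↦ Δ = 4.3 k_B T/2` (meV).
[cite: YoshidaEtAl2009LSCOTwoGapARPES, p. 3] -/
def ruleGap (T : ℝ) : ℝ := 4.3 * kBmeVPerKelvin * T / 2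

/-- Unfolding. [cite: YoshidaEtAl2009LSCOTwoGapARPES, p. 3] -/
theorem ruleGap_def (T : ℝ) : ruleGap T = 4.3 * kBmeVPerKelvin * T / 2 := rfl

/-- … and the inverse map `Δ ↦ T = 2Δ/(4.3 k_B)` (K). [cite: OkadaEtAl2011Bi2201ThreeEnergyScales, §3.5] -/
def ruleTemp (Δ : ℝ) : ℝ := 2 * Δ / (4.3 * kBmeVPerKelvin)

/-- Unfolding. [cite: OkadaEtAl2011Bi2201ThreeEnergyScales, §3.5] -/
theorem ruleTemp_def (Δ : ℝ) : ruleTemp Δ = 2 * Δ / (4.3 * kBmeVPerKelvin) := rfl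

/-- Round trip `ruleTemp (ruleGap T) = T`. [cite: OkadaEtAl2011Bi2201ThreeEnergyScales, §3.5] -/
theorem ruleTemp_ruleGap (T : ℝ) : ruleTemp (ruleGap T) = T := by
  have hk : kBmeVPerKelvin ≠ 0 := by
    have := kBmeVPerKelvin_bounds.1; exact (lt_trans (by norm_num) this).ne'
  unfold ruleTemp ruleGap
  field_simp

/-- At `2Δ/k_BT_c = 4.3` exactly, `tunnellingGapRatio (ruleGap T) T = 4.3` (`T ≠ 0`).
[cite: YoshidaEtAl2009LSCOTwoGapARPES, p. 3] -/
theorem tunnellingGapRatio_ruleGap {T : ℝ} (hT : T ≠ 0) : tunnellingGapRatio (ruleGap T) T = 4.3 := by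
  have hk : kBmeVPerKelvin ≠ 0 := by
    have := kBmeVPerKelvin_bounds.1; exact (lt_trans (by norm_num) this).ne'
  unfold tunnellingGapRatio ruleGap
  field_simp

/-- [Kondo 2007] optimally doped (Bi,Pb)₂(Sr,La)₂CuO₆₊δ, `T_c = 35 K`: near-nodal d-wave `∼ 15 meV ↦
2Δ/k_BT_c ∈ (9.94, 9.95)`; antinodal `∼ 40 meV ↦ (26.52, 26.53)`; the printed scaling of the OP-Bi2212
`40 meV` gap by the `T_c` ratio, `40·35/95 ∈ (14.73, 14.74)` (the «∼ 15»).
[cite: KondoEtAl2007Bi2201TwoEnergyScales, pp. 1, 3] -/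
theorem kondo2007_rows :
    (9.94 < tunnellingGapRatio 15 35 ∧ tunnellingGapRatio 15 35 < 9.95) ∧
    (26.52 < tunnellingGapRatio 40 35 ∧ tunnellingGapRatio 40 35 < 26.53) ∧
    (14.73 < (40 : ℝ) * 35 / 95 ∧ (40 : ℝ) * 35 / 95 < 14.74) := by
  refine ⟨⟨?_, ?_⟩, ⟨?_, ?_⟩, ⟨?_, ?_⟩⟩ <;>
    norm_num [tunnellingGapRatio, kBmeVPerKelvin, boltzmannSI, elementaryChargeSI_def]

/-- [Okada 2011] La-OP (`T_c = 33 K`) `Δ_sc0 = 14.1 meV ↦ (9.91, 9.92)`; Eu-OP (`18 K`) `12.0 ↦ (15.47, 15.48)`;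
coherent `Δ_sc0^eff = 5.6 meV ↦ (3.93, 3.94)` (printed «3.9 ± 0.8»), its bar `4.5 … 6.7 meV ↦ (3.16, 4.72)`;
Eu-OP `3.5 meV ↦ (4.51, 4.52)`. [cite: OkadaEtAl2011Bi2201ThreeEnergyScales, §3.1–3.2] -/
theorem okada2011_rows :
    (9.91 < tunnellingGapRatio 14.1 33 ∧ tunnellingGapRatio 14.1 33 < 9.92) ∧
    (15.47 < tunnellingGapRatio 12.0 18 ∧ tunnellingGapRatio 12.0 18 < 15.48) ∧
    (3.93 < tunnellingGapRatio 5.6 33 ∧ tunnellingGapRatio 5.6 33 < 3.94) ∧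
    (3.16 < tunnellingGapRatio 4.5 33 ∧ tunnellingGapRatio 6.7 33 < 4.72) ∧
    (4.51 < tunnellingGapRatio 3.5 18 ∧ tunnellingGapRatio 3.5 18 < 4.52) := by
  refine ⟨⟨?_, ?_⟩, ⟨?_, ?_⟩, ⟨?_, ?_⟩, ⟨?_, ?_⟩, ⟨?_, ?_⟩⟩ <;>
    norm_num [tunnellingGapRatio, kBmeVPerKelvin, boltzmannSI, elementaryChargeSI_def]

/-- The `4.3`-rule temperatures of [Okada 2011]'s scales: `Δ_sc0 = 14.1 ↦ T ∈ (76.0, 76.2) K`, `12.0 ↦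
(64.7, 64.8)`, `Δ_sc0^eff = 5.6 ↦ (30.2, 30.3)` (≈ the `T_c = 33 K` it is meant to track), and [Yoshida 2009]'s
`Δ* = 30 ↦ (161.9, 162.0)` (printed `T* ∼ 140 K`). [cite: OkadaEtAl2011Bi2201ThreeEnergyScales, §3.5] -/
theorem ruleTemp_rows :
    (76.0 < ruleTemp 14.1 ∧ ruleTemp 14.1 < 76.2) ∧ (64.7 < ruleTemp 12.0 ∧ ruleTemp 12.0 < 64.8) ∧
    (30.2 < ruleTemp 5.6 ∧ ruleTemp 5.6 < 30.3) ∧ (161.9 < ruleTemp 30 ∧ ruleTemp 30 < 162.0) := by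
  refine ⟨⟨?_, ?_⟩, ⟨?_, ?_⟩, ⟨?_, ?_⟩, ⟨?_, ?_⟩⟩ <;>
    norm_num [ruleTemp, kBmeVPerKelvin, boltzmannSI, elementaryChargeSI_def]

/-- The `4.3`-rule gaps at the printed temperatures: `T* = 150 K ↦ Δ* ∈ (27.79, 27.80) meV` (optimal
Bi2201/Bi2223), `140 K ↦ (25.93, 25.94)` (LSCO `x = 0.15`, printed `Δ* ∼ 30`), and `Δ_BCS = 4.3k_BT_c/2` at
`T_c = 39 / 33 / 14 K ↦ (7.22, 7.23) / (6.11, 6.12) / (2.59, 2.60) meV`.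
[cite: YoshidaEtAl2009LSCOTwoGapARPES, p. 3] -/
theorem ruleGap_rows :
    (27.79 < ruleGap 150 ∧ ruleGap 150 < 27.80) ∧ (25.93 < ruleGap 140 ∧ ruleGap 140 < 25.94) ∧
    (7.22 < ruleGap 39 ∧ ruleGap 39 < 7.23) ∧ (6.11 < ruleGap 33 ∧ ruleGap 33 < 6.12) ∧
    (2.59 < ruleGap 14 ∧ ruleGap 14 < 2.60) := by
  refine ⟨⟨?_, ?_⟩, ⟨?_, ?_⟩, ⟨?_, ?_⟩, ⟨?_, ?_⟩, ⟨?_, ?_⟩⟩ <;>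
    norm_num [ruleGap, kBmeVPerKelvin, boltzmannSI, elementaryChargeSI_def]

/-- [Yoshida 2009] LSCO `x = 0.15`: the printed pair `Δ* ∼ 30 meV`, `T* ∼ 140 K` gives `2Δ*/k_BT* ∈ (4.97, 4.98)`
— the «approximately 4.3». [cite: YoshidaEtAl2009LSCOTwoGapARPES, p. 3] -/
theorem yoshida2009_ratio : 4.97 < tunnellingGapRatio 30 140 ∧ tunnellingGapRatio 30 140 < 4.98 := by
  constructor <;> norm_num [tunnellingGapRatio, kBmeVPerKelvin, boltzmannSI, elementaryChargeSI_def]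

/-- [Boyer 2007] overdoped Pb-Bi2201, `T_c = 15 K`: `Δ_small = 6.7 meV ↦ (10.36, 10.37)`, its bar
`5.1 … 8.3 ↦ (7.89, 12.85)`; `Δ_large = 16 ↦ (24.75, 24.76)`.
[cite: BoyerEtAl2007Bi2201TwoGapsSTM, p. 3] -/
theorem boyer2007_rows :
    (10.36 < tunnellingGapRatio 6.7 15 ∧ tunnellingGapRatio 6.7 15 < 10.37) ∧
    (7.89 < tunnellingGapRatio 5.1 15 ∧ tunnellingGapRatio 8.3 15 < 12.85) ∧
    (24.75 < tunnellingGapRatio 16 15 ∧ tunnellingGapRatio 16 15 < 24.76) := by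
  refine ⟨⟨?_, ?_⟩, ⟨?_, ?_⟩, ⟨?_, ?_⟩⟩ <;>
    norm_num [tunnellingGapRatio, kBmeVPerKelvin, boltzmannSI, elementaryChargeSI_def]

/-- [Razzoli 2013] LSCO `x = 0.08` (`T_c = 20 K`): the `20 meV` diagonal gap gives `2Δ/k_BT ∈ (23.20, 23.21)`
at `T_c` but `(5.27, 5.28)` at its closing temperature `88 K` — it is not a superconducting ratio.
[cite: RazzoliEtAl2013LSCONodelessGap, pp. 1–3] -/
theorem razzoli2013_rows :
    (23.20 < tunnellingGapRatio 20 20 ∧ tunnellingGapRatio 20 20 < 23.21) ∧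
    (5.27 < tunnellingGapRatio 20 88 ∧ tunnellingGapRatio 20 88 < 5.28) := by
  refine ⟨⟨?_, ?_⟩, ⟨?_, ?_⟩⟩ <;>
    norm_num [tunnellingGapRatio, kBmeVPerKelvin, boltzmannSI, elementaryChargeSI_def]

/-- The located single-layer `2Δ/k_BT_c` members BY SCALE are pairwise ordered:
coherent `3.9` < rule `4.3` < nodal pairing `9.9` < STM small gap `10.4` < antinodal `26.5`.
[cite: OkadaEtAl2011Bi2201ThreeEnergyScales, §3.5] -/
theorem singleLayer_byScale_ordered :
    tunnellingGapRatio 5.6 33 < 4.3 ∧ 4.3 < tunnellingGapRatio 15 35 ∧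
    tunnellingGapRatio 15 35 < tunnellingGapRatio 6.7 15 ∧
    tunnellingGapRatio 6.7 15 < tunnellingGapRatio 40 35 := by
  refine ⟨?_, ?_, ?_, ?_⟩ <;>
    norm_num [tunnellingGapRatio, kBmeVPerKelvin, boltzmannSI, elementaryChargeSI_def]

end Literature.MathematicalPhysics.QuantumLattice.NonmonotonicDWaveGap

end
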